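import Mathlib
import Literature.RingTheory.MvPowerSeries.OptionEquivLeft
import Summits.ValiantsHypothesis.ValiantsHypothesis.Theorems.BinomialElusiveBinomialCandidateCorankOneEliminantLeadingForm
import Summits.ValiantsHypothesis.ValiantsHypothesis.Theorems.BinomialElusiveBinomialCandidateCorankTwoEliminantMembership

/-!
# Crux `BinomialElusive.BinomialCandidate` (stmt-ValiantsHypothesis-7392), line `registered`,
# skeleton v6 — stub `stub_nondegenerateCorankTwo`, wave 4: leading monomial of the two-level
# Weierstrass eliminant

This file proves the registered helper stub `corankTwo_leadingMonomial`.  PURE ALGEBRA.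
Setting: `A₁ := ℂ⟦W, X₁⟧ = MvPowerSeries (Option (Fin m)) ℂ` (`none = X₁`, `some i = W_i`,
special variable `w := W_{iw}`), `A := ℂ⟦W⟧ = MvPowerSeries (Fin m) ℂ`.  Level 1 (variable `X₂`
over `A₁`): `Fu` of order `2` at the augmentation ideal, `Fu`, `Fv`, `Fw + w` free of `w`,
`Fw(0) ∈ (X₂)`, remainder matrices `Mv`, `Mw` of the divisions of `X₂^j Fv`, `X₂^j Fw` by `Fu`,
`det Mv = X₁⁴ + O(X₁⁵)` on the `X₁`-axis.  Level 2 (variable `X₁` over `A`):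
`Rv' = optionEquivLeft (det Mv)`, `Rw' = optionEquivLeft (det Mw)`, remainder matrix `M₂` of the
divisions of `X₁^j Rw'` by `Rv'`.  Claim: `det M₂ (0) = 0` and `coeff_{w⁸} (det M₂) = 1`.

Proof.
1. `w`-freeness of the remainders (`CorankTwoLeadingMonomial.exists_killHom`, `rem_fixed`): the
   "kill `w`" ring endomorphism `π` of `A₁` fixes `Fu`, `Fv`, `Gw := Fw + w`; applying
   `PowerSeries.map π` to a division identity by `Fu` gives another Weierstrass division, so by
   uniqueness (`PowerSeries.IsWeierstrassDivisorAt.eq_of_mul_add_eq_mul_add`, divisor structure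
   `CorankTwoEliminant.isWeierstrassDivisorAt`) `π` fixes the remainders: `Mv` and
   `Nw := Mw + w • 1` (the remainder matrix of `X₂^j Gw`) are `w`-free.
2. Reduction to the origin (`rem_map_eq_zero`): since `Gw(0) ∈ (X₂)` and `Fu(0) ∈ (X₂²)`,
   `Nw_{lj}(0) = 0` for `l ≤ j`.
3. The two-variable restriction `θ := PowerSeries.map ρ ∘ optionEquivLeft : A₁ → ℂ⟦w⟧⟦X₁⟧`
   (`ρ` the `W_{iw}`-axis homomorphism `CorankOneLeadingForm.exists_axisHom`) has
   `[w^a X₁^n] θ F = coeff (single none n + single (some iw) a) F`; hence `X₁⁴ ∣ θ (det Mv)` and,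
   with `ψ := constantCoeff ∘ θ` (`ψ w = w`, `ψ Nw_{lj} = Nw_{lj}(0)`),
   `ψ (det Mw) = det (ψ Nw - w) = w²` (`Matrix.det_fin_two`).
4. Applying `PowerSeries.map ρ` to the level-2 identities and reading the coefficients of
   `X₁^l`, `l < 4`: `ρ (M₂)_{lj} = [X₁^{l-j}] θ(det Mw)` for `l ≥ j` and `0` for `l < j`, a lower
   triangular matrix with diagonal `w²`, so `ρ (det M₂) = w⁸` (`Matrix.det_of_lowerTriangular`),
   whence `det M₂ (0) = 0` and `coeff_{w⁸} (det M₂) = 1`.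
-/

-- layout Summits/ValiantsHypothesis/ValiantsHypothesis forces the duplicated namespace component
set_option linter.dupNamespace false

noncomputable section

namespace Summit.ValiantsHypothesis.ValiantsHypothesis.Theorems.BinomialCandidateStubs

open scoped BigOperators

namespace CorankTwoLeadingMonomial

/-! ## The kill-`s` endomorphism of `R⟦(X_t)_{t ∈ τ}⟧` -/

/-- The "kill the variable `s`" ring endomorphism of a multivariate power series ring: it keeps
the monomials not involving `X_s` and deletes the others (i.e. sets `X_s := 0`). -/
theorem exists_killHom {τ : Type*} {R : Type*} [CommSemiring R] (s : τ) :
    ∃ π : MvPowerSeries τ R →+* MvPowerSeries τ R,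
      ∀ f e, MvPowerSeries.coeff e (π f) = if e s = 0 then MvPowerSeries.coeff e f else 0 := by
  classical
  obtain ⟨π₀, hπ₀⟩ : ∃ π₀ : MvPowerSeries τ R → MvPowerSeries τ R,
      ∀ f e, MvPowerSeries.coeff e (π₀ f) = if e s = 0 then MvPowerSeries.coeff e f else 0 :=
    ⟨fun f e => if e s = 0 then f e else 0, fun _ _ => rfl⟩
  have hadd : ∀ f g, π₀ (f + g) = π₀ f + π₀ g := fun f g => by
    ext e
    simp only [map_add, hπ₀]
    split_ifs
    · rfl
    · exact (add_zero 0).symm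
  have hzero : π₀ 0 = 0 := by
    ext e
    rw [hπ₀, map_zero, ite_self]
  have hmul : ∀ f g, π₀ (f * g) = π₀ f * π₀ g := fun f g => by
    ext e
    rw [hπ₀, MvPowerSeries.coeff_mul, MvPowerSeries.coeff_mul]
    by_cases he : e s = 0
    · rw [if_pos he]
      refine Finset.sum_congr rfl fun p hp => ?_
      have hp' : p.1 s + p.2 s = 0 := by
        rw [← Finsupp.add_apply, Finset.HasAntidiagonal.mem_antidiagonal.mp hp, he]
      rw [hπ₀, hπ₀, if_pos (Nat.eq_zero_of_add_eq_zero_right hp'),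
        if_pos (Nat.eq_zero_of_add_eq_zero_left hp')]
    · rw [if_neg he]
      refine (Finset.sum_eq_zero fun p hp => ?_).symm
      have hp' : p.1 s + p.2 s = e s := by
        rw [← Finsupp.add_apply, Finset.HasAntidiagonal.mem_antidiagonal.mp hp]
      rw [hπ₀, hπ₀]
      by_cases h1 : p.1 s = 0
      · have h2 : ¬p.2 s = 0 := fun h2 => he (by rw [← hp', h1, h2])
        rw [if_neg h2, mul_zero]
      · rw [if_neg h1, zero_mul]
  have hone : π₀ 1 = 1 := by
    ext e
    rw [hπ₀, MvPowerSeries.coeff_one]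
    by_cases he : e = 0
    · subst he
      simp
    · rw [if_neg he, ite_self]
  let π : MvPowerSeries τ R →+* MvPowerSeries τ R :=
    { toFun := π₀
      map_one' := hone
      map_mul' := hmul
      map_zero' := hzero
      map_add' := hadd }
  exact ⟨π, hπ₀⟩

/-- A series free of `X_s` is fixed by the kill-`s` endomorphism. -/
theorem killHom_eq_self {τ : Type*} {R : Type*} [CommSemiring R] {s : τ}
    {π : MvPowerSeries τ R →+* MvPowerSeries τ R}
    (hπ : ∀ f e, MvPowerSeries.coeff e (π f) = if e s = 0 then MvPowerSeries.coeff e f else 0)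
    {f : MvPowerSeries τ R} (hf : ∀ e : τ →₀ ℕ, e s ≠ 0 → MvPowerSeries.coeff e f = 0) :
    π f = f := by
  ext e
  rw [hπ]
  split_ifs with he
  · rfl
  · exact (hf e he).symm

/-- A power series whose coefficients are free of `X_s` is fixed by `PowerSeries.map π`. -/
theorem map_killHom_eq_self {τ : Type*} {R : Type*} [CommSemiring R] {s : τ}
    {π : MvPowerSeries τ R →+* MvPowerSeries τ R}
    (hπ : ∀ f e, MvPowerSeries.coeff e (π f) = if e s = 0 then MvPowerSeries.coeff e f else 0)
    {F : PowerSeries (MvPowerSeries τ R)}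
    (hF : ∀ (j : ℕ) (e : τ →₀ ℕ), e s ≠ 0 → MvPowerSeries.coeff e (PowerSeries.coeff j F) = 0) :
    PowerSeries.map π F = F :=
  PowerSeries.ext fun j => by
    rw [PowerSeries.coeff_map]
    exact killHom_eq_self hπ (hF j)

/-! ## Uniqueness of remainders in Weierstrass division -/

/-- The remainder `Σ_l C(c_l) X^l` as the image of the polynomial `Σ_l C(c_l) X^l`. -/
theorem coe_sum_C_mul_X_pow {A : Type*} [CommSemiring A] {d : ℕ} (c : Fin d → A) :
    ((∑ l : Fin d, Polynomial.C (c l) * Polynomial.X ^ (l : ℕ) : Polynomial A) : PowerSeries A) =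
      ∑ l : Fin d, PowerSeries.C (c l) * PowerSeries.X ^ (l : ℕ) := by
  rw [← Polynomial.coeToPowerSeries.ringHom_apply, map_sum]
  refine Finset.sum_congr rfl fun l _ => ?_
  rw [map_mul, map_pow, Polynomial.coeToPowerSeries.ringHom_apply,
    Polynomial.coeToPowerSeries.ringHom_apply, Polynomial.coe_C, Polynomial.coe_X]

/-- Uniqueness of the remainder in Weierstrass division by a Weierstrass divisor `g` of order `d`:
two identities `q g + Σ_{l<d} C(c_l) X^l = q' g + Σ_{l<d} C(c'_l) X^l` force `c = c'`. -/
theorem rem_unique {A : Type*} [CommRing A] {I : Ideal A} [IsHausdorff I A] {g : PowerSeries A}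
    (H : g.IsWeierstrassDivisorAt I) {d : ℕ}
    (hd : (PowerSeries.map (Ideal.Quotient.mk I) g).order.toNat = d) {q q' : PowerSeries A}
    (c c' : Fin d → A)
    (h : q * g + ∑ l : Fin d, PowerSeries.C (c l) * PowerSeries.X ^ (l : ℕ) =
      q' * g + ∑ l : Fin d, PowerSeries.C (c' l) * PowerSeries.X ^ (l : ℕ)) (l : Fin d) :
    c l = c' l := by
  have hdeg : ∀ c₀ : Fin d → A,
      Polynomial.degree (∑ l : Fin d, Polynomial.C (c₀ l) * Polynomial.X ^ (l : ℕ)) <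
        ((PowerSeries.map (Ideal.Quotient.mk I) g).order.toNat : WithBot ℕ) := fun c₀ => by
    rw [hd]
    exact Polynomial.degree_sum_fin_lt c₀
  rw [← coe_sum_C_mul_X_pow c, ← coe_sum_C_mul_X_pow c', mul_comm q, mul_comm q'] at h
  obtain ⟨-, hr⟩ := H.eq_of_mul_add_eq_mul_add (hdeg c) (hdeg c') h
  have h2 := congrArg (fun r : Polynomial A => PowerSeries.coeff (l : ℕ) (r : PowerSeries A)) hr
  simp only [coe_sum_C_mul_X_pow, CorankOneLeadingForm.coeff_sum_C_mul_X_pow] at h2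
  exact h2

/-- **Remainders inherit symmetries.**  If a ring endomorphism `π` of the coefficient ring fixes
the Weierstrass divisor `g` (of order `d`) and the dividend `G`, then it fixes the remainder of
the division of `X^k G` by `g`. -/
theorem rem_fixed {A : Type*} [CommRing A] {I : Ideal A} [IsHausdorff I A] {g : PowerSeries A}
    (H : g.IsWeierstrassDivisorAt I) {d : ℕ}
    (hd : (PowerSeries.map (Ideal.Quotient.mk I) g).order.toNat = d) (π : A →+* A)
    (hg : PowerSeries.map π g = g) {G : PowerSeries A} (hG : PowerSeries.map π G = G) {k : ℕ}
    {q : PowerSeries A} (c : Fin d → A)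
    (h : PowerSeries.X ^ k * G =
      q * g + ∑ l : Fin d, PowerSeries.C (c l) * PowerSeries.X ^ (l : ℕ))
    (l : Fin d) : π (c l) = c l := by
  have h1 := congrArg (PowerSeries.map π) h
  simp only [map_mul, map_pow, map_add, map_sum, PowerSeries.map_X, PowerSeries.map_C, hg,
    hG] at h1
  exact rem_unique H hd (fun l => π (c l)) c (h1.symm.trans h) l

/-- **Reduction of a division identity.**  If `ε` is a ring homomorphism of the coefficient ring
killing the coefficients of `X^j`, `j < d`, of `g` and the constant coefficient of `G`, then it
kills the remainder coefficients `c_l`, `l ≤ k`, of `X^k G = q g + Σ_{l<d} C(c_l) X^l`. -/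
theorem rem_map_eq_zero {A B : Type*} [CommRing A] [CommRing B] (ε : A →+* B)
    {g G q : PowerSeries A} {d k : ℕ} {c : Fin d → A}
    (hg : ∀ j < d, ε (PowerSeries.coeff j g) = 0) (hG : ε (PowerSeries.coeff 0 G) = 0)
    (h : PowerSeries.X ^ k * G =
      q * g + ∑ l : Fin d, PowerSeries.C (c l) * PowerSeries.X ^ (l : ℕ))
    (l : Fin d) (hl : (l : ℕ) ≤ k) : ε (c l) = 0 := by
  obtain ⟨u, hu⟩ : (PowerSeries.X : PowerSeries B) ^ d ∣ PowerSeries.map ε g :=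
    PowerSeries.X_pow_dvd_iff.mpr fun j hj => by
      rw [PowerSeries.coeff_map]
      exact hg j hj
  have h1 := congrArg (PowerSeries.map ε) h
  simp only [map_mul, map_pow, map_add, map_sum, PowerSeries.map_X, PowerSeries.map_C, hu] at h1
  have h2 := congrArg (PowerSeries.coeff (l : ℕ)) h1
  rw [show PowerSeries.map ε q * (PowerSeries.X ^ d * u) =
      PowerSeries.X ^ d * (PowerSeries.map ε q * u) by ring, map_add,
    CorankOneLeadingForm.coeff_X_pow_mul_of_lt _ l.2, zero_add,
    CorankOneLeadingForm.coeff_sum_C_mul_X_pow, PowerSeries.coeff_X_pow_mul'] at h2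
  rw [← h2]
  split_ifs with hkl
  · obtain rfl : k = (l : ℕ) := Nat.le_antisymm hkl hl
    rw [Nat.sub_self, PowerSeries.coeff_map]
    exact hG
  · rfl

/-! ## The two-variable restriction `θ : ℂ⟦W, X₁⟧ → ℂ⟦w⟧⟦X₁⟧` -/

/-- The restriction of `ℂ⟦W, X₁⟧` to the `(W_{iw}, X₁)`-plane, landing in `ℂ⟦w⟧⟦X₁⟧`: it is
`PowerSeries.map ρ ∘ optionEquivLeft` for the `W_{iw}`-axis homomorphism `ρ`, and its
coefficients are `[w^a X₁^n] θ F = coeff (single none n + single (some iw) a) F`. -/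
theorem exists_twoVarHom {m : ℕ} (iw : Fin m) (ρ : MvPowerSeries (Fin m) ℂ →+* PowerSeries ℂ)
    (hρ : ∀ f n, PowerSeries.coeff n (ρ f) = MvPowerSeries.coeff (Finsupp.single iw n) f) :
    ∃ θ : MvPowerSeries (Option (Fin m)) ℂ →+* PowerSeries (PowerSeries ℂ),
      (∀ F, PowerSeries.map ρ (Literature.RingTheory.MvPowerSeries.optionEquivLeft F) = θ F) ∧
      ∀ F n a, PowerSeries.coeff a (PowerSeries.coeff n (θ F)) =
        MvPowerSeries.coeff (Finsupp.single none n + Finsupp.single (some iw) a) F := by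
  refine ⟨(PowerSeries.map ρ).comp
    (Literature.RingTheory.MvPowerSeries.optionEquivLeft (σ := Fin m) (R := ℂ)).toRingHom,
    fun F => rfl, fun F n a => ?_⟩
  have hidx : (Finsupp.single iw a).optionElim n =
      Finsupp.single none n + Finsupp.single (some iw) a := by
    ext j
    rcases j with _ | j
    · simp
    · simp [Finsupp.single_apply]
  rw [RingHom.comp_apply, RingEquiv.toRingHom_eq_coe, RingEquiv.coe_toRingHom,
    PowerSeries.coeff_map, hρ, Literature.RingTheory.MvPowerSeries.coeff_coeff_optionEquivLeft,
    hidx]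

end CorankTwoLeadingMonomial

open CorankTwoLeadingMonomial in
/-- **Leading monomial of the two-level Weierstrass eliminant** (wave-4 helper of the stub
`stub_nondegenerateCorankTwo`).  In the setting of the module docstring: the determinant `det M₂`
of the level-2 remainder matrix has constant coefficient `0` and `W_{iw}^8`-coefficient `1`. -/
theorem corankTwo_leadingMonomial :
    ∀ (m : ℕ) (iw : Fin m) (Fu Fv Fw : PowerSeries (MvPowerSeries (Option (Fin m)) ℂ))
      (Mv Mw : Matrix (Fin 2) (Fin 2) (MvPowerSeries (Option (Fin m)) ℂ))
      (Qv Qw : Fin 2 → PowerSeries (MvPowerSeries (Option (Fin m)) ℂ))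
      (Rv' Rw' : PowerSeries (MvPowerSeries (Fin m) ℂ))
      (M₂ : Matrix (Fin 4) (Fin 4) (MvPowerSeries (Fin m) ℂ)) (Q₂ : Fin 4 → PowerSeries (MvPowerSeries (Fin m) ℂ)),
      (∀ j < 2, MvPowerSeries.constantCoeff (PowerSeries.coeff j Fu) = 0) →
      MvPowerSeries.constantCoeff (PowerSeries.coeff 2 Fu) ≠ 0 →
      (∀ (j : ℕ) (e : Option (Fin m) →₀ ℕ), e (some iw) ≠ 0 → MvPowerSeries.coeff e (PowerSeries.coeff j Fu) = 0) →
      (∀ (j : ℕ) (e : Option (Fin m) →₀ ℕ), e (some iw) ≠ 0 → MvPowerSeries.coeff e (PowerSeries.coeff j Fv) = 0) →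
      (∀ (j : ℕ) (e : Option (Fin m) →₀ ℕ), e (some iw) ≠ 0 →
        MvPowerSeries.coeff e (PowerSeries.coeff j (Fw + PowerSeries.C (MvPowerSeries.X (some iw)))) = 0) →
      MvPowerSeries.constantCoeff (PowerSeries.coeff 0 Fw) = 0 →
      (∀ j : Fin 2, PowerSeries.X ^ (j : ℕ) * Fv =
        Qv j * Fu + ∑ l : Fin 2, PowerSeries.C (Mv l j) * PowerSeries.X ^ (l : ℕ)) →
      (∀ j : Fin 2, PowerSeries.X ^ (j : ℕ) * Fw =
        Qw j * Fu + ∑ l : Fin 2, PowerSeries.C (Mw l j) * PowerSeries.X ^ (l : ℕ)) →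
      (∀ n < 4, MvPowerSeries.coeff (Finsupp.single none n) Mv.det = 0) →
      MvPowerSeries.coeff (Finsupp.single none 4) Mv.det = 1 →
      Rv' = Literature.RingTheory.MvPowerSeries.optionEquivLeft Mv.det →
      Rw' = Literature.RingTheory.MvPowerSeries.optionEquivLeft Mw.det →
      (∀ j : Fin 4, PowerSeries.X ^ (j : ℕ) * Rw' =
        Q₂ j * Rv' + ∑ l : Fin 4, PowerSeries.C (M₂ l j) * PowerSeries.X ^ (l : ℕ)) →
      MvPowerSeries.constantCoeff M₂.det = 0 ∧ MvPowerSeries.coeff (Finsupp.single iw 8) M₂.det = 1 := by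
  intro m iw Fu Fv Fw Mv Mw Qv Qw Rv' Rw' M₂ Q₂ hu0 hu2 hFu hFv hGw hFw0 hdivV hdivW hdet _hdet4
    hRv hRw hdiv2
  classical
  subst hRv hRw
  -- the special variable `w = W_{iw}`
  set w : MvPowerSeries (Option (Fin m)) ℂ := MvPowerSeries.X (some iw) with hw_def
  -- `Fu` is a Weierstrass divisor of order `2` at the augmentation ideal
  have H := CorankTwoEliminant.isWeierstrassDivisorAt Fu 2 hu0 hu2
  have hord := CorankTwoEliminant.order_toNat_eq Fu 2 hu0 hu2
  -- (1) the kill-`w` endomorphism fixes `Fu`, `Fv`, `Gw = Fw + C w`, hence the remainders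
  obtain ⟨π, hπ⟩ := exists_killHom (R := ℂ) (some iw : Option (Fin m))
  have hπFu : PowerSeries.map π Fu = Fu := map_killHom_eq_self hπ hFu
  have hπFv : PowerSeries.map π Fv = Fv := map_killHom_eq_self hπ hFv
  have hπGw : PowerSeries.map π (Fw + PowerSeries.C w) = Fw + PowerSeries.C w :=
    map_killHom_eq_self hπ hGw
  have hMv : ∀ l j : Fin 2, π (Mv l j) = Mv l j := fun l j =>
    rem_fixed H hord π hπFu hπFv (fun l => Mv l j) (hdivV j) l
  -- the remainder matrix `Nw = Mw + w • 1` of the divisions of `X₂^j Gw` by `Fu`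
  obtain ⟨Nw, hNw⟩ : ∃ Nw : Fin 2 → Fin 2 → MvPowerSeries (Option (Fin m)) ℂ,
      ∀ l j, Nw l j = Mw l j + if l = j then w else 0 := ⟨_, fun _ _ => rfl⟩
  have hdivN : ∀ j : Fin 2, PowerSeries.X ^ (j : ℕ) * (Fw + PowerSeries.C w) =
      Qw j * Fu + ∑ l : Fin 2, PowerSeries.C (Nw l j) * PowerSeries.X ^ (l : ℕ) := by
    intro j
    have hsum : ∑ l : Fin 2, PowerSeries.C (Nw l j) * PowerSeries.X ^ (l : ℕ) =
        ∑ l : Fin 2, PowerSeries.C (Mw l j) * PowerSeries.X ^ (l : ℕ) +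
          PowerSeries.C w * PowerSeries.X ^ (j : ℕ) := by
      have h1 : ∀ l : Fin 2, PowerSeries.C (Nw l j) * PowerSeries.X ^ (l : ℕ) =
          PowerSeries.C (Mw l j) * PowerSeries.X ^ (l : ℕ) +
            PowerSeries.C (if l = j then w else 0) * PowerSeries.X ^ (l : ℕ) := fun l => by
        rw [hNw, map_add, add_mul]
      simp only [h1, Finset.sum_add_distrib]
      congr 1
      rw [Finset.sum_eq_single j, if_pos rfl]
      · intro l _ hl
        rw [if_neg hl, map_zero, zero_mul]
      · intro h
        exact absurd (Finset.mem_univ j) h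
    rw [hsum, mul_add, hdivW j, ← add_assoc, mul_comm (PowerSeries.X ^ (j : ℕ)) (PowerSeries.C w)]
  have hNwfix : ∀ l j : Fin 2, π (Nw l j) = Nw l j := fun l j =>
    rem_fixed H hord π hπFu hπGw (fun l => Nw l j) (hdivN j) l
  -- (2) reduction to the origin: `Nw_{lj}(0) = 0` for `l ≤ j`
  have hG0 : MvPowerSeries.constantCoeff (PowerSeries.coeff 0 (Fw + PowerSeries.C w)) = 0 := by
    rw [map_add, PowerSeries.coeff_zero_C, map_add, hFw0, hw_def, MvPowerSeries.constantCoeff_X,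
      add_zero]
  have hNw0 : ∀ l j : Fin 2, (l : ℕ) ≤ j → MvPowerSeries.constantCoeff (Nw l j) = 0 :=
    fun l j hlj => rem_map_eq_zero MvPowerSeries.constantCoeff hu0 hG0 (hdivN j) l hlj
  -- (3) the axis homomorphism `ρ` and the two-variable restriction `θ`
  obtain ⟨ρ, hρ⟩ := CorankOneLeadingForm.exists_axisHom iw
  obtain ⟨θ, hθρ, hθ⟩ := exists_twoVarHom iw ρ hρ
  -- `det Mv` is `w`-free, so `X₁⁴ ∣ θ (det Mv)`
  have hπdet : π Mv.det = Mv.det := by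
    rw [RingHom.map_det, RingHom.mapMatrix_apply]
    congr 1
    ext l j
    rw [Matrix.map_apply, hMv]
  have hA : ∀ n < 4, PowerSeries.coeff n (θ Mv.det) = 0 := by
    intro n hn
    ext a
    rw [hθ, map_zero]
    by_cases ha : a = 0
    · rw [ha, Finsupp.single_zero, add_zero]
      exact hdet n hn
    · rw [← hπdet, hπ, if_neg]
      simp [ha]
  obtain ⟨u, hu⟩ : (PowerSeries.X : PowerSeries (PowerSeries ℂ)) ^ 4 ∣ θ Mv.det :=
    PowerSeries.X_pow_dvd_iff.mpr hA
  -- `ψ := constantCoeff ∘ θ` (the `w`-axis restriction of `A₁`) and `ψ (det Mw) = w²`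
  set ψ : MvPowerSeries (Option (Fin m)) ℂ →+* PowerSeries ℂ :=
    (PowerSeries.constantCoeff (R := PowerSeries ℂ)).comp θ with hψ_def
  have hψ : ∀ F a, PowerSeries.coeff a (ψ F) =
      MvPowerSeries.coeff (Finsupp.single (some iw) a) F := fun F a => by
    rw [hψ_def, RingHom.comp_apply, ← PowerSeries.coeff_zero_eq_constantCoeff_apply, hθ,
      Finsupp.single_zero, zero_add]
  have hψw : ψ w = PowerSeries.X := by
    ext a
    rw [hψ, hw_def, MvPowerSeries.coeff_X, PowerSeries.coeff_X]
    by_cases ha : a = 1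
    · rw [if_pos (by rw [ha]), if_pos ha]
    · rw [if_neg (fun h => ha (Finsupp.single_injective _ h)), if_neg ha]
  have hψN : ∀ l j : Fin 2, ψ (Nw l j) = PowerSeries.C (MvPowerSeries.constantCoeff (Nw l j)) := by
    intro l j
    ext a
    rw [hψ, PowerSeries.coeff_C]
    split_ifs with ha
    · rw [ha, Finsupp.single_zero, MvPowerSeries.coeff_zero_eq_constantCoeff_apply]
    · rw [← hNwfix l j, hπ, if_neg]
      rwa [Finsupp.single_eq_same]
  have hB : ψ Mw.det = PowerSeries.X ^ 2 := by
    have hMwN : ∀ l j : Fin 2, Mw l j = Nw l j - if l = j then w else 0 := fun l j => by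
      rw [hNw, add_sub_cancel_right]
    rw [Matrix.det_fin_two, hMwN 0 0, hMwN 0 1, hMwN 1 0, hMwN 1 1, if_pos rfl, if_pos rfl,
      if_neg (by decide), if_neg (by decide)]
    simp only [map_sub, map_mul, map_zero, sub_zero, hψN, hψw, hNw0 0 0 le_rfl,
      hNw0 1 1 le_rfl, hNw0 0 1 (by decide), zero_sub, zero_mul]
    ring
  -- (4) level 2 under `PowerSeries.map ρ`: a lower triangular matrix with diagonal `w²`
  have hP : ∀ l j : Fin 4, ρ (M₂ l j) =
      if (j : ℕ) ≤ (l : ℕ) then PowerSeries.coeff ((l : ℕ) - j) (θ Mw.det) else 0 := by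
    intro l j
    have h := congrArg (PowerSeries.map ρ) (hdiv2 j)
    simp only [map_mul, map_pow, map_add, map_sum, PowerSeries.map_X, PowerSeries.map_C, hθρ,
      hu] at h
    have h2 := congrArg (PowerSeries.coeff (l : ℕ)) h
    rw [show PowerSeries.map ρ (Q₂ j) * (PowerSeries.X ^ 4 * u) =
        PowerSeries.X ^ 4 * (PowerSeries.map ρ (Q₂ j) * u) by ring, map_add,
      CorankOneLeadingForm.coeff_X_pow_mul_of_lt _ l.2, zero_add,
      CorankOneLeadingForm.coeff_sum_C_mul_X_pow, PowerSeries.coeff_X_pow_mul'] at h2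
    exact h2.symm
  have htri : (ρ.mapMatrix M₂).BlockTriangular OrderDual.toDual := by
    intro l j hlj
    have hlj' : (l : ℕ) < j := Fin.lt_def.mp (OrderDual.toDual_lt_toDual.mp hlj)
    rw [RingHom.mapMatrix_apply, Matrix.map_apply, hP, if_neg (not_le.mpr hlj')]
  have hdet2 : ρ M₂.det = PowerSeries.X ^ 8 := by
    rw [RingHom.map_det, Matrix.det_of_lowerTriangular _ htri]
    have hdiag : ∀ j : Fin 4, ρ.mapMatrix M₂ j j = PowerSeries.X ^ 2 := fun j => by
      rw [RingHom.mapMatrix_apply, Matrix.map_apply, hP, if_pos le_rfl, Nat.sub_self,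
        PowerSeries.coeff_zero_eq_constantCoeff_apply]
      exact hB
    simp only [hdiag, Finset.prod_const, Finset.card_univ, Fintype.card_fin]
    ring
  refine ⟨?_, ?_⟩
  · rw [← CorankOneLeadingForm.axisHom_constantCoeff ρ hρ, hdet2, map_pow,
      PowerSeries.constantCoeff_X, zero_pow (by norm_num)]
  · rw [← hρ, hdet2, PowerSeries.coeff_X_pow, if_pos rfl]

end Summit.ValiantsHypothesis.ValiantsHypothesis.Theorems.BinomialCandidateStubs

end
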